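import Mathlib
import Literature.Analysis.Matrix.HadamardInequality
import Literature.NumberTheory.DiophantineApproximation.VandermondeDiscrepancy
import Summits.Ventures.DiscreteObjects.Mahler.SymmetricRootIntegrality
import Summits.Ventures.DiscreteObjects.Mahler.DobrowolskiLemma
import Summits.Ventures.DiscreteObjects.Mahler.OddCoefficientsResultant
import Summits.Ventures.DiscreteObjects.Mahler.PisotLowerBound
import Summits.Ventures.DiscreteObjects.Mahler.MahlerMeasureCompXPow

/-!
# A weak Dobrowolski bound in the kernel: `M(f) > 1 + 1/(22 d²)` unconditionally, `> 1 + 1/(22 d)` conditionally (venture `DiscreteObjects`, target L)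

Cell `pub-namedobj`, seat `pub-namedobj-mahler-g26`. Framing: lottery ticket; floor = certified bounds/negative ranges.

[cite: MckeeSmyth2021, Theorem 3.11] (weak form of Dobrowolski 1979): a nonzero algebraic integer `α` of degree `d`, not a
root of unity, has `M(α) > 1 + 1/(22d)`.  KERNEL REPLICATION of the printed argument for a monic irreducible non-cyclotomic
`f ∈ ℤ[X]` (`f(0) ≠ 0`) of degree `d` and a prime `p`: the Vandermonde product bound ([MckeeSmyth2021, Lemma 3.7],
re-derived inline from the tree's Hadamard inequality; cf. `VandermondeProductBound`) on the `2d` points `(α_i^p, α_i)` splits as `D_p · R · R · D_1` with `D_1 = ∏_{i≠j}|α_i - α_j| ≥ 1`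
(separability), `D_p = ∏_{i≠j}|α_i^p - α_j^p| ≥ 1` WHEN NONZERO (an integer: `SymmetricRootIntegrality`) and
`R = ∏_{i,j}|α_i^p - α_j| = |Res(f, f(X^p))| ≥ p^d` (`DobrowolskiLemma`), whence **`p ≤ 2d · M(f)^{2(p+1)}` whenever the `p`-th
powers of the roots are pairwise distinct** (`prime_le_two_mul_natDegree_mul_measure_pow`); with a prime `p ∈ (6d, 12d)`
(Bertrand) this is `M(f) > 1 + 1/(22d)` CONDITIONALLY on that distinctness (`weakDobrowolski_of_pow_nodup`; the printed proof
removes the condition by Lemma 3.8 — Galois equivalence classes — not yet in the kernel).  UNCONDITIONALLY: every prime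
`p > d² + 1` has the distinctness property (`pow_nodup_roots_of_prime_gt_sq`: `ζ = α_i/α_j` would be a primitive `p`-th root of
unity in `ℚ(α_i, α_j)`, of degree `≤ d²`, while `[ℚ(ζ):ℚ] = p - 1`), so a prime `p ∈ (6d², 12d²)` gives
**`M(f) > 1 + 1/(22 d²)`** (`weakDobrowolski_sq`).  No new mathematics: the printed method with a folklore weakening.
-/

namespace Summit.Ventures.DiscreteObjects.Mahler

open Polynomial Finset IntermediateField Literature.NumberTheory.DiophantineApproximation.Discrepancy

/-- [MckeeSmyth2021, Lemma 3.7] for an arbitrary finite index type. -/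
theorem prod_erase_norm_sub_le_card {ι : Type*} [Fintype ι] [DecidableEq ι] (z : ι → ℂ) :
    ∏ u, ∏ v ∈ univ.erase u, ‖z u - z v‖ ≤
      (Fintype.card ι : ℝ) ^ Fintype.card ι * (∏ u, max 1 ‖z u‖) ^ (2 * (Fintype.card ι - 1)) := by
  set n := Fintype.card ι with hn
  set e := Fintype.equivFin ι with he
  have h : ∏ a : Fin n, ∏ b ∈ univ.erase a, ‖(z ∘ e.symm) a - (z ∘ e.symm) b‖ ≤
      (n : ℝ) ^ n * (∏ a, max 1 ‖(z ∘ e.symm) a‖) ^ (2 * (n - 1)) := by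
    have hsq : ∏ a : Fin n, ∏ b ∈ univ.erase a, ‖(z ∘ e.symm) a - (z ∘ e.symm) b‖ =
        vandermondeAbs (z ∘ e.symm) ^ 2 := by
      rw [← prod_Ioi_sq_eq_prod_erase (fun i j => ‖(z ∘ e.symm) i - (z ∘ e.symm) j‖)
        (fun i j => norm_sub_rev _ _)]
      unfold vandermondeAbs
      exact congrArg (· ^ 2) (Finset.prod_congr rfl fun i _ => Finset.prod_congr rfl fun j _ => norm_sub_rev _ _)
    rw [hsq, vandermondeAbs_eq_norm_det]
    have hH := Literature.Analysis.Matrix.norm_det_sq_le_of_entry_le (Matrix.vandermonde (z ∘ e.symm))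
      (fun i => (max 1 ‖(z ∘ e.symm) i‖) ^ (n - 1)) (fun i j => by
        rw [Matrix.vandermonde_apply, norm_pow]
        calc ‖(z ∘ e.symm) i‖ ^ (j : ℕ) ≤ (max 1 ‖(z ∘ e.symm) i‖) ^ (j : ℕ) :=
              pow_le_pow_left₀ (norm_nonneg _) (le_max_right _ _) _
          _ ≤ (max 1 ‖(z ∘ e.symm) i‖) ^ (n - 1) := pow_le_pow_right₀ (le_max_left _ _) (by omega))
    refine hH.trans (le_of_eq ?_)
    rw [Finset.prod_mul_distrib, Finset.prod_const, Finset.card_univ, Fintype.card_fin, ← Finset.prod_pow]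
    exact congrArg _ (Finset.prod_congr rfl fun i _ => by rw [← pow_mul, mul_comm])
  have h1 : ∏ a : Fin n, ∏ b ∈ univ.erase a, ‖(z ∘ e.symm) a - (z ∘ e.symm) b‖ =
      ∏ u, ∏ v ∈ univ.erase u, ‖z u - z v‖ := by
    refine Fintype.prod_equiv e.symm _ _ fun a => ?_
    exact Finset.prod_equiv e.symm (fun b => by simp [e.symm.injective.ne_iff]) (fun b _ => rfl)
  have h2 : ∏ a : Fin n, max 1 ‖(z ∘ e.symm) a‖ = ∏ u, max 1 ‖z u‖ :=
    Fintype.prod_equiv e.symm _ _ fun a => rfl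
  rw [h1, h2] at h
  exact h

/-- The inner product over `univ.erase u` as a product over all `v` with the diagonal term replaced by `1`. -/
theorem prod_erase_eq_prod_ite {ι : Type*} [Fintype ι] [DecidableEq ι] (u : ι) (g : ι → ℝ) :
    ∏ v ∈ univ.erase u, g v = ∏ v, (if v = u then 1 else g v) := by
  rw [← Finset.mul_prod_erase univ (fun v => if v = u then (1 : ℝ) else g v) (Finset.mem_univ u), if_pos rfl,
    one_mul]
  exact Finset.prod_congr rfl fun v hv => by rw [if_neg (Finset.ne_of_mem_erase hv)]

/-- Products over the root multiset versus over an enumeration `α` of it (values in a commutative monoid `β`). -/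
theorem multiset_prod_map_eq_prod {β : Type*} [CommMonoid β] {n : ℕ} {R : Multiset ℂ} (α : Fin n → ℂ)
    (hα : (Finset.univ.val.map α : Multiset ℂ) = R) (g : ℂ → β) : (R.map g).prod = ∏ i, g (α i) := by
  rw [← hα, Multiset.map_map]
  rfl

/-- **[MckeeSmyth2021, proof of Theorem 3.11], conditional core.**  Let `f ∈ ℤ[X]` be monic, irreducible, `f(0) ≠ 0`,
with no cyclotomic factor, of degree `d ≥ 1`, and let `p` be a prime such that the `p`-th powers of the complex roots of
`f` are pairwise distinct.  Then `p ≤ 2d · M(f)^{2(p+1)}`. -/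
theorem prime_le_two_mul_natDegree_mul_measure_pow (f : ℤ[X]) (hmon : f.Monic) (hirr : Irreducible f)
    (h0 : f.coeff 0 ≠ 0) (hcf : ∀ m : ℕ, 0 < m → ¬ cyclotomic m ℤ ∣ f) (hdeg : 0 < f.natDegree) {p : ℕ}
    (hp : p.Prime) (hinj : (((f.map (Int.castRingHom ℂ)).roots).map (fun a => a ^ p)).Nodup) :
    (p : ℝ) ≤ 2 * f.natDegree * intMahlerMeasure f ^ (2 * (p + 1)) := by
  classical
  -- the roots as a family `α : Fin n → ℂ`
  set g := f.map (Int.castRingHom ℂ) with hg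
  set R := g.roots with hR
  have hgmon : g.Monic := hmon.map _
  have hsplit : g.Splits := IsAlgClosed.splits g
  have hcard : R.card = f.natDegree := by
    rw [hR, splits_iff_card_roots.1 hsplit, hg, natDegree_map_eq_of_injective (Int.castRingHom ℂ).injective_int]
  set L := R.toList with hL
  set n := L.length with hn
  have hnd : n = f.natDegree := by rw [hn, hL, Multiset.length_toList, hcard]
  set α : Fin n → ℂ := fun i => L.get i with hαdef
  have hα : (Finset.univ.val.map α : Multiset ℂ) = R := by
    rw [Fin.univ_val_map]
    have hof : List.ofFn α = L := List.ofFn_get L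
    rw [hof]
    exact Multiset.coe_toList R
  have hnpos : 0 < n := by omega
  -- distinctness: the roots, and their `p`-th powers
  have hRnodup : R.Nodup := nodup_roots_of_irreducible hirr hdeg
  have hαinj : Function.Injective α := by
    have : (Finset.univ.val.map α).Nodup := by rw [hα]; exact hRnodup
    exact (Multiset.nodup_map_iff_inj_on Finset.univ.nodup).1 this |> fun h a b hab =>
      h a (Finset.mem_univ a) b (Finset.mem_univ b) hab
  have hαpinj : Function.Injective fun i => α i ^ p := by
    have : (Finset.univ.val.map fun i => α i ^ p).Nodup := by
      have e1 : (Finset.univ.val.map fun i => α i ^ p) = R.map (fun a => a ^ p) := by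
        rw [← hα, Multiset.map_map]; rfl
      rw [e1]; exact hinj
    exact (Multiset.nodup_map_iff_inj_on Finset.univ.nodup).1 this |> fun h a b hab =>
      h a (Finset.mem_univ a) b (Finset.mem_univ b) hab
  -- the four products
  set Dp : ℝ := ∏ i : Fin n, ∏ j ∈ univ.erase i, ‖α i ^ p - α j ^ p‖ with hDp
  set D1 : ℝ := ∏ i : Fin n, ∏ j ∈ univ.erase i, ‖α i - α j‖ with hD1
  set Rp : ℝ := ∏ i : Fin n, ∏ j : Fin n, ‖α i ^ p - α j‖ with hRp
  have hDp1 : 1 ≤ Dp := by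
    refine one_le_norm_prod_pow_sub_pow f hmon α (by rw [hα]) p ?_
    rw [Finset.prod_ne_zero_iff]
    intro i _
    rw [Finset.prod_ne_zero_iff]
    intro j hj
    exact sub_ne_zero.2 fun h => Finset.ne_of_mem_erase hj (hαpinj h).symm
  have hD11 : 1 ≤ D1 := by
    refine one_le_norm_prod_sub f hmon α (by rw [hα]) ?_
    rw [Finset.prod_ne_zero_iff]
    intro i _
    rw [Finset.prod_ne_zero_iff]
    intro j hj
    exact sub_ne_zero.2 fun h => Finset.ne_of_mem_erase hj (hαinj h).symm
  -- `R = |Res(f, f(X^p))| ≥ p^d`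
  have hRes : ((p : ℝ) ^ f.natDegree) ≤ Rp := by
    have h1 := prime_pow_le_abs_resultant_expand_of_irreducible hirr h0 hcf hp
    have h2 := resultant_intCast_eq (f := f) (G := expand ℤ p f) (N := f.natDegree * p) (by rw [natDegree_expand])
    have hev : ∀ a : ℂ, ((expand ℤ p f).map (Int.castRingHom ℂ)).eval a = ∏ j : Fin n, (a ^ p - α j) := by
      intro a
      rw [map_expand, expand_eval]
      conv_lhs => rw [← hg, Splits.eq_prod_roots_of_monic hsplit hgmon, eval_multiset_prod]
      rw [Multiset.map_map, ← hR, multiset_prod_map_eq_prod α hα]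
      simp
    have h3 : ((f.resultant (expand ℤ p f) f.natDegree (f.natDegree * p) : ℤ) : ℂ) =
        ∏ i : Fin n, ∏ j : Fin n, (α i ^ p - α j) := by
      rw [h2, ← hg, hgmon.leadingCoeff, one_pow, one_mul, ← hR]
      rw [show (R.map ((expand ℤ p f).map (Int.castRingHom ℂ)).eval) = R.map (fun a => ∏ j : Fin n, (a ^ p - α j))
        from Multiset.map_congr rfl fun a _ => hev a]
      exact multiset_prod_map_eq_prod α hα _
    have h4 : ‖((f.resultant (expand ℤ p f) f.natDegree (f.natDegree * p) : ℤ) : ℂ)‖ = Rp := by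
      rw [h3, norm_prod, hRp]
      exact Finset.prod_congr rfl fun i _ => norm_prod _ _
    rw [← h4, Complex.norm_intCast]
    have h5 : ((p : ℤ) ^ f.natDegree : ℝ) ≤ ((|f.resultant (expand ℤ p f) f.natDegree (f.natDegree * p)| : ℤ) : ℝ) := by
      exact_mod_cast h1
    rw [Int.cast_abs] at h5
    exact_mod_cast h5
  -- the `2n`-point configuration `z = (α^p, α)`
  set z : Fin n ⊕ Fin n → ℂ := fun u => Sum.elim (fun i => α i ^ p) α u with hz
  have hcomm : Rp = ∏ i : Fin n, ∏ j : Fin n, ‖α i - α j ^ p‖ := by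
    rw [hRp, Finset.prod_comm]
    exact Finset.prod_congr rfl fun i _ => Finset.prod_congr rfl fun j _ => norm_sub_rev _ _
  have hsplitProd : ∏ u, ∏ v ∈ univ.erase u, ‖z u - z v‖ =
      Dp * Rp * ((∏ i : Fin n, ∏ j : Fin n, ‖α i - α j ^ p‖) * D1) := by
    simp_rw [prod_erase_eq_prod_ite]
    rw [Fintype.prod_sum_type]
    simp_rw [Fintype.prod_sum_type]
    have eA : ∀ i : Fin n, (∏ j : Fin n, if (Sum.inl j : Fin n ⊕ Fin n) = Sum.inl i then (1 : ℝ) else ‖z (Sum.inl i) - z (Sum.inl j)‖)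
        = ∏ j ∈ univ.erase i, ‖α i ^ p - α j ^ p‖ := by
      intro i
      rw [prod_erase_eq_prod_ite]
      exact Finset.prod_congr rfl fun j _ => by simp [hz]
    have eB : ∀ i : Fin n, (∏ j : Fin n, if (Sum.inr j : Fin n ⊕ Fin n) = Sum.inl i then (1 : ℝ) else ‖z (Sum.inl i) - z (Sum.inr j)‖)
        = ∏ j : Fin n, ‖α i ^ p - α j‖ := fun i => Finset.prod_congr rfl fun j _ => by simp [hz]
    have eC : ∀ i : Fin n, (∏ j : Fin n, if (Sum.inl j : Fin n ⊕ Fin n) = Sum.inr i then (1 : ℝ) else ‖z (Sum.inr i) - z (Sum.inl j)‖)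
        = ∏ j : Fin n, ‖α i - α j ^ p‖ := fun i => Finset.prod_congr rfl fun j _ => by simp [hz]
    have eD : ∀ i : Fin n, (∏ j : Fin n, if (Sum.inr j : Fin n ⊕ Fin n) = Sum.inr i then (1 : ℝ) else ‖z (Sum.inr i) - z (Sum.inr j)‖)
        = ∏ j ∈ univ.erase i, ‖α i - α j‖ := by
      intro i
      rw [prod_erase_eq_prod_ite]
      exact Finset.prod_congr rfl fun j _ => by simp [hz]
    simp_rw [eA, eB, eC, eD, Finset.prod_mul_distrib]
    rfl
  rw [← hcomm] at hsplitProd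
  -- `∏ max(1,|z_u|) = M^p · M`
  have hM : intMahlerMeasure f = ∏ i : Fin n, max 1 ‖α i‖ := by
    unfold intMahlerMeasure
    rw [mahlerMeasure_eq_leadingCoeff_mul_prod_roots, ← hg, hgmon.leadingCoeff, norm_one, one_mul, ← hR]
    exact multiset_prod_map_eq_prod α hα _
  have hM1 : 1 ≤ intMahlerMeasure f := by
    rw [hM]
    have : ∏ i : Fin n, (1 : ℝ) ≤ ∏ i, max 1 ‖α i‖ :=
      Finset.prod_le_prod (fun _ _ => zero_le_one) fun _ _ => le_max_left _ _
    simpa using this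
  have hzmax : ∏ u, max 1 ‖z u‖ = intMahlerMeasure f ^ p * intMahlerMeasure f := by
    rw [Fintype.prod_sum_type, hM, ← Finset.prod_pow]
    congr 1
    exact Finset.prod_congr rfl fun i _ => by simp only [hz, Sum.elim_inl, norm_pow, (max_one_pow (norm_nonneg _) p).symm]
  -- combine
  have hU := prod_erase_norm_sub_le_card z
  rw [hsplitProd, hzmax, Fintype.card_sum, Fintype.card_fin] at hU
  set M := intMahlerMeasure f with hMdef
  have hRp0 : 0 ≤ Rp := Finset.prod_nonneg fun i _ => Finset.prod_nonneg fun j _ => norm_nonneg _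
  have hkey : ((p : ℝ) ^ n) ^ 2 ≤ ((2 * n : ℕ) : ℝ) ^ (2 * n) * (M ^ (2 * (p + 1))) ^ (2 * n) := by
    have hlow : ((p : ℝ) ^ n) ^ 2 ≤ Dp * Rp * (Rp * D1) := by
      rw [← hnd] at hRes
      have hpn : 0 ≤ (p : ℝ) ^ n := by positivity
      calc ((p : ℝ) ^ n) ^ 2 = 1 * (p : ℝ) ^ n * ((p : ℝ) ^ n * 1) := by ring
        _ ≤ Dp * Rp * (Rp * D1) := by
            apply mul_le_mul (mul_le_mul hDp1 hRes hpn (by linarith)) (mul_le_mul hRes hD11 zero_le_one hRp0)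
              (by positivity) (by nlinarith)
    have hup : ((n + n : ℕ) : ℝ) ^ (n + n) * (M ^ p * M) ^ (2 * (n + n - 1)) ≤
        ((2 * n : ℕ) : ℝ) ^ (2 * n) * (M ^ (2 * (p + 1))) ^ (2 * n) := by
      rw [show n + n = 2 * n by ring]
      apply mul_le_mul_of_nonneg_left _ (by positivity)
      rw [← pow_succ, ← pow_mul, ← pow_mul]
      refine pow_le_pow_right₀ hM1 ?_
      have e1 : 2 * (2 * n - 1) ≤ 2 * (2 * n) := by omega
      calc (p + 1) * (2 * (2 * n - 1)) ≤ (p + 1) * (2 * (2 * n)) := Nat.mul_le_mul_left (p + 1) e1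
        _ = 2 * (p + 1) * (2 * n) := by ring
    exact hlow.trans (hU.trans hup)
  have h2 : ((p : ℝ) ^ n) ^ 2 = ((p : ℝ)) ^ (2 * n) := by rw [← pow_mul, mul_comm]
  rw [h2, ← mul_pow] at hkey
  have hfin : (p : ℝ) ≤ ((2 * n : ℕ) : ℝ) * M ^ (2 * (p + 1)) :=
    (pow_le_pow_iff_left₀ (by positivity) (by positivity) (by omega : 2 * n ≠ 0)).1 hkey
  rw [hnd] at hfin
  push_cast at hfin
  linarith [hfin]

/-- Numerical step: `e^{12/11} < 3`. -/
theorem exp_twelve_elevenths_lt_three : Real.exp (12 / 11) < 3 := by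
  have h1 : Real.exp (12 / 11) = Real.exp 1 * Real.exp (1 / 11) := by
    rw [← Real.exp_add]; norm_num
  have h2 : Real.exp (1 / 11 : ℝ) ≤ 1 / (1 - 1 / 11) :=
    Real.exp_bound_div_one_sub_of_interval (by norm_num) (by norm_num)
  have h3 := Real.exp_one_lt_d9
  rw [h1]
  calc Real.exp 1 * Real.exp (1 / 11) ≤ 2.7182818286 * (1 / (1 - 1 / 11)) :=
        mul_le_mul h3.le h2 (Real.exp_nonneg _) (by norm_num)
    _ < 3 := by norm_num

/-- Numerical step: `M ≥ 1`, `M^{24k} > 3` (`k ≥ 1`) force `M > 1 + 1/(22k)`, because `(1 + 1/(22k))^{24k} ≤ e^{12/11} < 3`. -/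
theorem one_add_inv_lt_of_pow_gt_three {M : ℝ} {k : ℕ} (hk : 0 < k) (hM : 1 ≤ M) (h : 3 < M ^ (24 * k)) :
    1 + 1 / (22 * (k : ℝ)) < M := by
  by_contra hle
  push Not at hle
  have hkpos : (0 : ℝ) < k := by exact_mod_cast hk
  have h1 : M ^ (24 * k) ≤ (1 + 1 / (22 * (k : ℝ))) ^ (24 * k) := pow_le_pow_left₀ (by linarith) hle _
  have h2 : (1 + 1 / (22 * (k : ℝ))) ^ (24 * k) ≤ Real.exp (12 / 11) := by
    have h3 : (1 + 1 / (22 * (k : ℝ))) ≤ Real.exp (1 / (22 * k)) := by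
      have := Real.add_one_le_exp (1 / (22 * (k : ℝ)))
      linarith
    calc (1 + 1 / (22 * (k : ℝ))) ^ (24 * k) ≤ (Real.exp (1 / (22 * k))) ^ (24 * k) :=
          pow_le_pow_left₀ (by positivity) h3 _
      _ = Real.exp (12 / 11) := by
          rw [← Real.exp_nat_mul]
          congr 1
          push_cast
          field_simp
          ring
  linarith [exp_twelve_elevenths_lt_three]

/-- **Weak Dobrowolski bound, conditional form** [cite: MckeeSmyth2021, Theorem 3.11]: if `f ∈ ℤ[X]` is monic,
irreducible, `f(0) ≠ 0`, non-cyclotomic, of degree `d ≥ 1`, and for some prime `p` with `6d < p < 12d` the `p`-th powers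
of its roots are pairwise distinct, then `M(f) > 1 + 1/(22 d)`.  (The hypothesis on `p` is always satisfiable after the
reduction of [MckeeSmyth2021, Lemma 3.8], not yet in the kernel; Bertrand's postulate supplies the prime.) -/
theorem weakDobrowolski_of_pow_nodup (f : ℤ[X]) (hmon : f.Monic) (hirr : Irreducible f) (h0 : f.coeff 0 ≠ 0)
    (hcf : ∀ m : ℕ, 0 < m → ¬ cyclotomic m ℤ ∣ f) (hdeg : 0 < f.natDegree) {p : ℕ} (hp : p.Prime)
    (hp1 : 6 * f.natDegree < p) (hp2 : p < 12 * f.natDegree)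
    (hinj : (((f.map (Int.castRingHom ℂ)).roots).map (fun a => a ^ p)).Nodup) :
    1 + 1 / (22 * (f.natDegree : ℝ)) < intMahlerMeasure f := by
  set d := f.natDegree with hd
  set M := intMahlerMeasure f with hM
  have hmain := prime_le_two_mul_natDegree_mul_measure_pow f hmon hirr h0 hcf hdeg hp hinj
  rw [← hd, ← hM] at hmain
  have hdpos : (0 : ℝ) < d := by exact_mod_cast hdeg
  have hM1 : 1 ≤ M := by
    have h := abs_leadingCoeff_le_intMahlerMeasure f
    rw [hmon.leadingCoeff] at h
    simpa using h
  -- `M^{2(p+1)} > 3` and `2(p+1) ≤ 24 d`, so `M^{24 d} > 3`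
  have hgt3 : 3 < M ^ (2 * (p + 1)) := by
    have : (6 * d : ℝ) < p := by exact_mod_cast hp1
    have hMp : 0 < M ^ (2 * (p + 1)) := by positivity
    by_contra hle
    push Not at hle
    nlinarith
  have h24 : M ^ (2 * (p + 1)) ≤ M ^ (24 * d) := pow_le_pow_right₀ hM1 (by omega)
  have hgt : 3 < M ^ (24 * d) := lt_of_lt_of_le hgt3 h24
  exact one_add_inv_lt_of_pow_gt_three hdeg hM1 hgt

/-- **Large primes separate the powers of the roots.**  If `f ∈ ℤ[X]` is monic irreducible of degree `d` with `f(0) ≠ 0`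
and `p` is a prime with `p > d² + 1`, then `a ↦ a^p` is injective on the complex roots of `f`. -/
theorem pow_nodup_roots_of_prime_gt_sq (f : ℤ[X]) (hmon : f.Monic) (hirr : Irreducible f) (h0 : f.coeff 0 ≠ 0)
    {p : ℕ} (hp : p.Prime) (hpd : f.natDegree ^ 2 + 1 < p) :
    (((f.map (Int.castRingHom ℂ)).roots).map (fun a => a ^ p)).Nodup := by
  classical
  set g := f.map (Int.castRingHom ℂ) with hg
  have hdeg : 0 < f.natDegree := by
    rw [Polynomial.Monic.natDegree_pos hmon]
    exact fun h => hirr.not_isUnit (h ▸ isUnit_one)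
  have hnodup : g.roots.Nodup := nodup_roots_of_irreducible hirr hdeg
  rw [Multiset.nodup_map_iff_inj_on hnodup]
  intro a ha b hb hab
  by_contra hne
  have hg0 : g ≠ 0 := (hmon.map (Int.castRingHom ℂ)).ne_zero
  -- the roots are nonzero
  have hroot0 : ∀ x ∈ g.roots, x ≠ 0 := by
    intro x hx hx0
    have h := (mem_roots hg0).1 hx
    rw [hx0, IsRoot, hg, eval_map, eval₂_at_zero, eq_intCast, Int.cast_eq_zero] at h
    exact h0 h
  have ha0 := hroot0 a ha
  have hb0 := hroot0 b hb
  -- `ζ = a / b` is a primitive `p`-th root of unity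
  set ζ : ℂ := a / b with hζ
  have hζp : ζ ^ p = 1 := by
    rw [hζ, div_pow, hab, div_self (pow_ne_zero _ hb0)]
  have hζ1 : ζ ≠ 1 := fun h => hne (by rwa [hζ, div_eq_one_iff_eq hb0] at h)
  haveI := Fact.mk hp
  have hprim : IsPrimitiveRoot ζ p := IsPrimitiveRoot.iff_orderOf.2 (orderOf_eq_prime hζp hζ1)
  -- the roots are algebraic of degree `d` over `ℚ`
  have hfQ : Irreducible (f.map (algebraMap ℤ ℚ)) :=
    ((hirr.isPrimitive hdeg.ne').irreducible_iff_irreducible_map_fraction_map (K := ℚ)).mp hirr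
  have hminpoly : ∀ x ∈ g.roots, IsIntegral ℚ x ∧ minpoly ℚ x = f.map (algebraMap ℤ ℚ) := by
    intro x hx
    have hx0 : aeval x (f.map (algebraMap ℤ ℚ)) = 0 := by
      rw [aeval_map_algebraMap, aeval_def, ← eval_map, algebraMap_int_eq, ← hg]
      exact (mem_roots hg0).1 hx
    have hint : IsIntegral ℚ x := ⟨f.map (algebraMap ℤ ℚ), hmon.map _, by rwa [aeval_def] at hx0⟩
    exact ⟨hint, (minpoly.eq_of_irreducible_of_monic hfQ hx0 (hmon.map _)).symm⟩
  obtain ⟨haint, hamin⟩ := hminpoly a ha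
  obtain ⟨hbint, hbmin⟩ := hminpoly b hb
  have hdegQ : (f.map (algebraMap ℤ ℚ)).natDegree = f.natDegree :=
    natDegree_map_eq_of_injective (algebraMap ℤ ℚ).injective_int f
  have hfa : Module.finrank ℚ ℚ⟮a⟯ = f.natDegree := by rw [adjoin.finrank haint, hamin, hdegQ]
  have hfb : Module.finrank ℚ ℚ⟮b⟯ = f.natDegree := by rw [adjoin.finrank hbint, hbmin, hdegQ]
  haveI : FiniteDimensional ℚ ℚ⟮a⟯ := adjoin.finiteDimensional haint
  haveI : FiniteDimensional ℚ ℚ⟮b⟯ := adjoin.finiteDimensional hbint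
  have hsup : Module.finrank ℚ ↥(ℚ⟮a⟯ ⊔ ℚ⟮b⟯) ≤ f.natDegree ^ 2 := by
    refine (finrank_sup_le ℚ⟮a⟯ ℚ⟮b⟯).trans ?_
    rw [hfa, hfb, sq]
  -- `ζ ∈ ℚ(a, b)`, and `[ℚ(ζ):ℚ] = p - 1`
  have hζmem : ζ ∈ ℚ⟮a⟯ ⊔ ℚ⟮b⟯ := by
    refine div_mem ?_ ?_
    · exact (le_sup_left : ℚ⟮a⟯ ≤ ℚ⟮a⟯ ⊔ ℚ⟮b⟯) (mem_adjoin_simple_self ℚ a)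
    · exact (le_sup_right : ℚ⟮b⟯ ≤ ℚ⟮a⟯ ⊔ ℚ⟮b⟯) (mem_adjoin_simple_self ℚ b)
  have hle : ℚ⟮ζ⟯ ≤ ℚ⟮a⟯ ⊔ ℚ⟮b⟯ := adjoin_simple_le_iff.2 hζmem
  have hζint : IsIntegral ℚ ζ := ⟨X ^ p - 1, monic_X_pow_sub_C 1 hp.ne_zero, by simp [hζp]⟩
  haveI : NeZero (p : ℚ) := ⟨by exact_mod_cast hp.ne_zero⟩
  have hfz : Module.finrank ℚ ℚ⟮ζ⟯ = p - 1 := by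
    rw [adjoin.finrank hζint, ← hprim.minpoly_eq_cyclotomic_of_irreducible (cyclotomic.irreducible_rat hp.pos),
      natDegree_cyclotomic, Nat.totient_prime hp]
  have hfin := IntermediateField.finrank_le_of_le_right hle
  rw [hfz] at hfin
  have : p - 1 ≤ f.natDegree ^ 2 := hfin.trans hsup
  omega

/-- **An unconditional polynomial-rate Lehmer bound.**  Every monic irreducible `f ∈ ℤ[X]` with `f(0) ≠ 0`, no cyclotomic
factor and degree `d ≥ 1` satisfies `M(f) > 1 + 1/(22 d²)` (the printed method of [cite: MckeeSmyth2021, Theorem 3.11] with a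
prime `p ∈ (6d², 12d²)`, for which the `p`-th powers of the roots are automatically distinct). -/
theorem weakDobrowolski_sq (f : ℤ[X]) (hmon : f.Monic) (hirr : Irreducible f) (h0 : f.coeff 0 ≠ 0)
    (hcf : ∀ m : ℕ, 0 < m → ¬ cyclotomic m ℤ ∣ f) (hdeg : 0 < f.natDegree) :
    1 + 1 / (22 * ((f.natDegree : ℝ) ^ 2)) < intMahlerMeasure f := by
  set d := f.natDegree with hd
  -- a prime `6d² < p < 12d²`
  obtain ⟨p, hp, hlt, hle⟩ := Nat.exists_prime_lt_and_le_two_mul (6 * d ^ 2) (by nlinarith)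
  have hp12 : p < 12 * d ^ 2 := by
    rcases hle.eq_or_lt with h | h
    · exfalso
      have : 2 ∣ p := ⟨6 * d ^ 2, h⟩
      have h2 := (Nat.prime_dvd_prime_iff_eq Nat.prime_two hp).1 this
      nlinarith
    · omega
  have hinj := pow_nodup_roots_of_prime_gt_sq f hmon hirr h0 hp (by nlinarith)
  have hmain := prime_le_two_mul_natDegree_mul_measure_pow f hmon hirr h0 hcf hdeg hp hinj
  rw [← hd] at hmain
  set M := intMahlerMeasure f with hM
  have hdpos : (0 : ℝ) < d := by exact_mod_cast hdeg
  have hM1 : 1 ≤ M := by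
    have h := abs_leadingCoeff_le_intMahlerMeasure f
    rw [hmon.leadingCoeff] at h
    simpa using h
  -- `M^{2(p+1)} > 3` and `2(p+1) ≤ 24 d²`
  have hgt3 : 3 < M ^ (2 * (p + 1)) := by
    have h6 : (6 * d ^ 2 : ℝ) < p := by exact_mod_cast hlt
    have hMp : 0 < M ^ (2 * (p + 1)) := by positivity
    by_contra hle'
    push Not at hle'
    have hd1 : (1 : ℝ) ≤ d := by exact_mod_cast hdeg
    nlinarith
  have h24 : M ^ (2 * (p + 1)) ≤ M ^ (24 * d ^ 2) := pow_le_pow_right₀ hM1 (by omega)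
  have hgt : 3 < M ^ (24 * d ^ 2) := lt_of_lt_of_le hgt3 h24
  have h := one_add_inv_lt_of_pow_gt_three (k := d ^ 2) (by positivity) hM1 hgt
  push_cast at h
  exact h

end Summit.Ventures.DiscreteObjects.Mahler
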